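import Literature.NumberTheory.EllipticCurves.IsogenyDualKernelKummerDescent
import Literature.NumberTheory.EllipticCurves.IsogenyBaseChangeFieldProofs
import Literature.NumberTheory.EllipticCurves.IsogenyCompProofs
import Literature.NumberTheory.EllipticCurves.H1UnramifiedFinite
import HarnessLib

/-!
# The `ψ`-Selmer condition at a `K`-field `L`, read through the Kummer invariant: a locally trivial
# class has Kummer invariant a LOCAL DESCENT VALUE (Silverman, *AEC*, X.4.2 / X.4.9 / Ex. 10.1, at `K_v`)

PROOF file (theorems and three bookkeeping definitions with bodies; no named fact, no `sorry`), topic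
`NumberTheory/EllipticCurves`; sequel of `IsogenyDualKernelMuCharacter` / `IsogenyDualKernelKummerDescent`.
Setting: `E/K` elliptic (`char K = 0`), `p ≠ char K` prime, `T ∈ E(K̄)` a `Γ_K`-fixed point of order `p`,
`φ : E → E'` with `ker φ = ⟨T⟩`, `ψ : E' → E` with `ψ ∘ φ = [p]`; `L ⊇ K` ANY field (a completion `K_v`), and
`φ_L : E_L → E'_L`, `ψ_L : E'_L → E_L` isogenies over `L` compatible with `φ, ψ` along
`ι_* : E(K̄) → E_L(L̄)` (they exist: tree `Isogeny.exists_baseChange_field`), `#ker φ_L = p`.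

* §1 `baseExt W L = ι_*` (`localPointsEquivGeomPoints ∘ pointsMap`): injective, `Γ`-compatible
  (`baseExt_smul`), `closureEmb` compatible with `resGal` (`closureEmb_resGal_smul`).
* §2 Over `L` the pair `(φ_L, ψ_L)` and `T_L = ι_* T` satisfy the hypotheses of the companion files:
  `comp_eq_zsmul_of_baseChange` (`ψ_L ∘ φ_L = [p]` on ALL of `E_L(L̄)`, by rigidity on the infinite set
  `ι_* E(K̄)`, tree `eq_of_mem_geomEndRing_of_eqOn_infinite`), `zsmul_baseExt_T`, `baseExt_T_ne_zero`,
  `smul_baseExt_T`, `ker_baseChange_eq_zmultiples`.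
* §3 `kerTransfer`, `resKerHom`, **`resCocycle`** — restriction of a cocycle `c : Γ_K → ker ψ` to
  `c_L : Γ_L → ker ψ_L`, `τ ↦ ι_*(c(τ|_K̄))`; **`exists_coboundary_of_mem_selmerLocalKer`** — the Selmer local
  condition at `L` (`[c] ∈ ψ.selmerLocalKer L`) says `c_L(τ) = τQ' − Q'` for some `Q' ∈ E'_L(L̄)`.
* §4 **`exists_pow_weilPairingFun_baseExt_eq`** — the Weil pairings of `E` and `E_L` agree along `ι_*` up to
  a FIXED unit exponent: `e_L(ι_* S, ι_* T) = ι(e(S, T))^k`, `p ∤ k`, for all `S ∈ E[p]` (both sides are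
  characters of `E[p]` with kernel `⟨T⟩` onto `μ_p`).
* §5 **`exists_localKummerGenerator`** — a global Kummer generator `(α, a)` of `c` (`χ(cσ) = σα/α`, `αᵖ = a`)
  gives the local one `(ι(α)^k, a^k)` of `c_L`. Hence, with `IsogenyDualKernelKummerDescent`:
  `exists_pow_eq_pow_of_psi_eq_zero` (`P = O`: `aᵏ ∈ Lˣᵖ`) and
  **`exists_pow_mul_pow_eq_value_of_coboundary`** (`P ∉ {O, T_L}`: `aᵏ · uᵖ · f(P₀) = f(P)`, `u ∈ Lˣ`), where
  `P = ψ_L(Q') ∈ E_L(L)` is the local point — THE LOCAL CONDITION OF `Sel^ψ` READ IN `Lˣ/Lˣᵖ` is «the Kummer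
  invariant is a local descent value `f_T(P)/f_T(P₀)`» (Silverman X.4.9 / Ex. 10.1(c) at the completion; the
  `μ₅`-side of the door at `5`, route ShaPrimaryTransfer).

## References

* [SilvermanAEC2009] J. H. Silverman, *The Arithmetic of Elliptic Curves*, 2nd ed., III.§8 (Prop. III.8.1),
  Thm. X.4.2, Prop. X.4.9, Exercise 10.1(c); I.§3, II.2.1 (base change of morphisms).
* [SerreGaloisCohomology1997] J.-P. Serre, *Galois Cohomology*, I.§2.4 (compatible pairs), II.§1.1–1.2.
* [Fisher2001FiveSevenDescent] T. Fisher, JEMS 3 (2001), §1.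

## Design

One universe `u` (`K L : Type u`, forced by `ContinuousCohomology.map`); `open scoped Classical`; the
`Γ`-actions on the kernels are the `Isogeny.kerAction`s (`letI`). The isogenies over `L` enter as DATA with
their compatibility hypotheses (`hφL`, `hψL`, as in `Isogeny.apply_apply_add_smul_of_baseChange_field`), so
that the file applies to the output of `Isogeny.exists_baseChange_field`.
-/

noncomputable section

open scoped Classical

universe u

namespace WeierstrassCurve.Isogeny

open Literature.NumberTheory.EllipticCurves Literature.NumberTheory.GaloisRepresentations
  Literature.NumberTheory.GaloisRepresentations.DiscreteGaloisModule Field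
  Literature.NumberTheory.EllipticCurves.WeierstrassFunctionField

/-! ## §1 `ι_* : E(K̄) → E_L(L̄)` and the embedding `ι : K̄ → L̄` -/

section BaseExt

variable {K : Type u} [Field K] (W : WeierstrassCurve K) (L : Type u) [Field L] [Algebra K L]

/-- `ι_* : E(K̄) → E_L(L̄)`: the chosen embedding `ι = closureEmb L : K̄ → L̄` on coordinates, read on the
geometric points of the base change `E_L` (`localPointsEquivGeomPoints ∘ pointsMap`). Silverman, *AEC*, VIII.§1.
[cite: SilvermanAEC2009, VIII.§1] -/
def baseExt : W.geomPoints →+ geomPoints (W.baseChange L) :=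
  (localPointsEquivGeomPoints W L).toAddMonoidHom.comp (pointsMap W L)

/-- Unfolding `baseExt`. [cite: SilvermanAEC2009, VIII.§1] -/
theorem baseExt_apply (P : W.geomPoints) :
    baseExt W L P = localPointsEquivGeomPoints W L (pointsMap W L P) :=
  rfl

/-- `ι_*` is injective. [cite: SilvermanAEC2009, VIII.§1] -/
theorem baseExt_injective : Function.Injective (baseExt W L) :=
  Isogeny.localPointsEquivGeomPoints_pointsMap_injective L W

/-- `ι_*` is compatible with the Galois actions along `τ ↦ τ|_K̄ = resGal L τ`: `ι_* (τ|_K̄ • P) = τ • ι_* P`.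
[cite: SerreGaloisCohomology1997, I.§2.4] -/
theorem baseExt_smul (τ : absoluteGaloisGroup L) (P : W.geomPoints) :
    baseExt W L (resGal (K := K) L τ • P) = τ • baseExt W L P := by
  rw [baseExt_apply, baseExt_apply, pointsMap_smul, localPointsEquivGeomPoints_smul]

omit W in
/-- `ι (τ|_K̄ • x) = τ • ι x` for `x ∈ K̄`, `ι = closureEmb L`, `τ ∈ Γ_L`. [cite: SerreGaloisCohomology1997, II.§1.1] -/
theorem closureEmb_resGal_smul (τ : absoluteGaloisGroup L) (x : AlgebraicClosure K) :
    closureEmb (K := K) L (resGal (K := K) L τ • x) = τ • closureEmb (K := K) L x :=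
  apply_resGalAuxOfEmb_apply (closureEmb (K := K) L) τ x

end BaseExt

/-! ## §2 The pair `(φ_L, ψ_L)` and `T_L = ι_* T` over `L` -/

section OverL

variable {K : Type u} [Field K] {W W' : WeierstrassCurve K} [W.IsElliptic] [W'.IsElliptic]
  (φ : Isogeny W W') (ψ : Isogeny W' W) {p : ℕ} [Fact p.Prime] [NeZero (p : K)]
  (h : ∀ P, ψ (φ P) = (p : ℤ) • P)
  (T : W.geomPoints) (hT : (p : ℤ) • T = 0) (hT0 : T ≠ 0)
  (hTfix : ∀ σ : absoluteGaloisGroup K, σ • T = T)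
  (hker : φ.toAddMonoidHom.ker = AddSubgroup.zmultiples T)
  (L : Type u) [Field L] [Algebra K L] [(W.baseChange L).IsElliptic] [(W'.baseChange L).IsElliptic]
  (φL : Isogeny (W.baseChange L) (W'.baseChange L)) (ψL : Isogeny (W'.baseChange L) (W.baseChange L))
  (hφL : ∀ P : W.geomPoints, φL (baseExt W L P) = baseExt W' L (φ P))
  (hψL : ∀ Q : W'.geomPoints, ψL (baseExt W' L Q) = baseExt W L (ψ Q))
  (hφLcard : Nat.card φL.toAddMonoidHom.ker = p)

include h hφL hψL in
omit [W'.IsElliptic] [Fact p.Prime] [NeZero (p : K)] [(W'.baseChange L).IsElliptic] in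
/-- **`ψ_L ∘ φ_L = [p]` on all of `E_L(L̄)`**: both sides are geometric endomorphisms of `E_L` agreeing on the
infinite set `ι_* E(K̄)` (rigidity, tree `eq_of_mem_geomEndRing_of_eqOn_infinite`).
[cite: SilvermanAEC2009, III.§4 (End(E)) and III.4.9] -/
theorem comp_eq_zsmul_of_baseChange (Q : geomPoints (W.baseChange L)) : ψL (φL Q) = (p : ℤ) • Q := by
  set f : AddMonoid.End (geomPoints (W.baseChange L)) := (ψL.comp φL).toAddMonoidHom with hf
  have hfapp : ∀ R, f R = ψL (φL R) := fun _ ↦ rfl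
  have hfmem : f ∈ (W.baseChange L).geomEndRing :=
    (W.baseChange L).endRing_le_geomEndRing (ψL.comp φL).toAddMonoidHom_mem_endRing
  have hgmem : ((p : ℤ) : AddMonoid.End (geomPoints (W.baseChange L))) ∈ (W.baseChange L).geomEndRing :=
    intCast_mem _ (p : ℤ)
  have key := eq_of_mem_geomEndRing_of_eqOn_infinite (W.baseChange L) hfmem hgmem
    (infinite_range_localPointsEquivGeomPoints_pointsMap L W) (by
      rintro _ ⟨P, rfl⟩
      change f (baseExt W L P) =
        (((p : ℤ) : AddMonoid.End (geomPoints (W.baseChange L))) : _ →+ _) (baseExt W L P)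
      rw [hfapp, AddMonoid.End.intCast_apply, hφL, hψL, h, map_zsmul])
  have hQ := congrArg (fun F : AddMonoid.End (geomPoints (W.baseChange L)) ↦ F Q) key
  change f Q = (((p : ℤ) : AddMonoid.End (geomPoints (W.baseChange L))) : _ →+ _) Q at hQ
  rwa [hfapp, AddMonoid.End.intCast_apply] at hQ

include hT in
omit [W.IsElliptic] [W'.IsElliptic] [Fact p.Prime] [NeZero (p : K)] [(W.baseChange L).IsElliptic]
  [(W'.baseChange L).IsElliptic] in
/-- `p • T_L = O`. [cite: SilvermanAEC2009, VIII.§1] -/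
theorem zsmul_baseExt_T : (p : ℤ) • baseExt W L T = 0 := by
  rw [← map_zsmul, hT, map_zero]

include hT0 in
omit [W.IsElliptic] [W'.IsElliptic] [Fact p.Prime] [NeZero (p : K)] [(W.baseChange L).IsElliptic]
  [(W'.baseChange L).IsElliptic] in
/-- `T_L ≠ O`. [cite: SilvermanAEC2009, VIII.§1] -/
theorem baseExt_T_ne_zero : baseExt W L T ≠ 0 := fun h0 ↦
  hT0 (baseExt_injective W L (by rw [h0, map_zero]))

include hTfix in
omit [W.IsElliptic] [W'.IsElliptic] [Fact p.Prime] [NeZero (p : K)] [(W.baseChange L).IsElliptic]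
  [(W'.baseChange L).IsElliptic] in
/-- `T_L` is `Γ_L`-fixed. [cite: SerreGaloisCohomology1997, I.§2.4] -/
theorem smul_baseExt_T (τ : absoluteGaloisGroup L) : τ • baseExt W L T = baseExt W L T := by
  rw [← baseExt_smul, hTfix]

include hφL hφLcard hT hT0 hker in
omit [W.IsElliptic] [W'.IsElliptic] [NeZero (p : K)] [(W.baseChange L).IsElliptic] [(W'.baseChange L).IsElliptic] in
/-- **`ker φ_L = ⟨T_L⟩`** (`T_L ∈ ker φ_L` and both have `p` elements). [cite: SilvermanAEC2009, Thm. III.4.10(c)] -/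
theorem ker_baseChange_eq_zmultiples : φL.toAddMonoidHom.ker = AddSubgroup.zmultiples (baseExt W L T) := by
  have hTmem : T ∈ φ.toAddMonoidHom.ker := by rw [hker]; exact AddSubgroup.mem_zmultiples T
  rw [AddMonoidHom.mem_ker, coe_toAddMonoidHom] at hTmem
  refine ker_eq_zmultiples_of_natCard_eq φL (baseExt W L T) hφLcard ?_ (zsmul_baseExt_T T hT L)
    (baseExt_T_ne_zero T hT0 L)
  rw [AddMonoidHom.mem_ker, coe_toAddMonoidHom, hφL, hTmem, map_zero]

/-! ## §3 Restriction of a cocycle `Γ_K → ker ψ` to `Γ_L → ker ψ_L`; the Selmer condition at `L` -/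

include hψL in
omit [W.IsElliptic] [W'.IsElliptic] [Fact p.Prime] [NeZero (p : K)] [(W.baseChange L).IsElliptic]
  [(W'.baseChange L).IsElliptic] in
/-- `ι_*` carries `ker ψ` into `ker ψ_L`. [cite: SilvermanAEC2009, VIII.§1] -/
theorem baseExt_mem_ker (X : ψ.toAddMonoidHom.ker) : baseExt W' L (X : W'.geomPoints) ∈ ψL.toAddMonoidHom.ker := by
  have hX := X.2
  rw [AddMonoidHom.mem_ker, coe_toAddMonoidHom] at hX ⊢
  rw [hψL, hX, map_zero]

/-- **The kernel transfer `ker ψ → ker ψ_L`, `X ↦ ι_* X`.** [cite: SilvermanAEC2009, VIII.§1] -/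
def kerTransfer (hψL : ∀ Q : W'.geomPoints, ψL (baseExt W' L Q) = baseExt W L (ψ Q)) :
    ψ.toAddMonoidHom.ker →+ ψL.toAddMonoidHom.ker where
  toFun X := ⟨baseExt W' L (X : W'.geomPoints), baseExt_mem_ker ψ L ψL hψL X⟩
  map_zero' := Subtype.ext (by simp)
  map_add' X Y := Subtype.ext (by simp)

omit [W.IsElliptic] [W'.IsElliptic] [Fact p.Prime] [NeZero (p : K)] [(W.baseChange L).IsElliptic]
  [(W'.baseChange L).IsElliptic] in
/-- Values of `kerTransfer`. [cite: SilvermanAEC2009, VIII.§1] -/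
@[simp]
theorem coe_kerTransfer (X : ψ.toAddMonoidHom.ker) :
    ((kerTransfer ψ L ψL hψL X : ψL.toAddMonoidHom.ker) : geomPoints (W'.baseChange L)) =
      baseExt W' L (X : W'.geomPoints) :=
  rfl

omit [W.IsElliptic] [W'.IsElliptic] [Fact p.Prime] [NeZero (p : K)] [(W.baseChange L).IsElliptic]
  [(W'.baseChange L).IsElliptic] in
/-- `kerTransfer` is compatible with the Galois actions along `resGal L`. [cite: SerreGaloisCohomology1997, I.§2.4] -/
theorem kerTransfer_smul (τ : absoluteGaloisGroup L) (X : ψ.toAddMonoidHom.ker) :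
    letI := ψ.kerAction; letI := ψL.kerAction
    kerTransfer ψ L ψL hψL (resGal (K := K) L τ • X) = τ • kerTransfer ψ L ψL hψL X := by
  letI := ψ.kerAction; letI := ψL.kerAction
  apply Subtype.ext
  rw [coe_kerTransfer, kerAction_coe_smul, kerAction_coe_smul, coe_kerTransfer, baseExt_smul]

/-- The compatible pair `(resGal L, kerTransfer)` as a morphism `res (ker ψ) ⟶ ker ψ_L` in `TopRep ℤ Γ_L`
(tree `resHomOfEquivariant`). [cite: SerreGaloisCohomology1997, I.§2.4] -/
def resKerHom (hψL : ∀ Q : W'.geomPoints, ψL (baseExt W' L Q) = baseExt W L (ψ Q)) :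
    letI := ψ.kerAction; letI := ψL.kerAction
    TopRep.res (resGal (K := K) L : absoluteGaloisGroup L →* absoluteGaloisGroup K)
        (discreteTopRep (absoluteGaloisGroup K) ψ.toAddMonoidHom.ker) ⟶
      discreteTopRep (absoluteGaloisGroup L) ψL.toAddMonoidHom.ker :=
  letI := ψ.kerAction; letI := ψL.kerAction
  resHomOfEquivariant (resGal (K := K) L) (kerTransfer ψ L ψL hψL) (kerTransfer_smul ψ L ψL hψL)

/-- **The restricted cocycle `c_L : Γ_L → ker ψ_L`, `τ ↦ ι_*(c(τ|_K̄))`.** [cite: SerreGaloisCohomology1997, I.§2.4] -/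
def resCocycle (hψL : ∀ Q : W'.geomPoints, ψL (baseExt W' L Q) = baseExt W L (ψ Q))
    (c : letI := ψ.kerAction
      contOneCocycles (discreteTopRep (absoluteGaloisGroup K) ψ.toAddMonoidHom.ker)) :
    letI := ψL.kerAction
    contOneCocycles (discreteTopRep (absoluteGaloisGroup L) ψL.toAddMonoidHom.ker) :=
  letI := ψ.kerAction; letI := ψL.kerAction
  contOneCocycles.pullback (resGal (K := K) L) (resKerHom ψ L ψL hψL) c

omit [W.IsElliptic] [W'.IsElliptic] [Fact p.Prime] [NeZero (p : K)] [(W.baseChange L).IsElliptic]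
  [(W'.baseChange L).IsElliptic] in
/-- Values of the restricted cocycle: `c_L(τ) = ι_*(c(τ|_K̄))`. [cite: SerreGaloisCohomology1997, I.§2.4] -/
theorem coe_resCocycle_apply
    (c : letI := ψ.kerAction
      contOneCocycles (discreteTopRep (absoluteGaloisGroup K) ψ.toAddMonoidHom.ker))
    (τ : absoluteGaloisGroup L) :
    (((resCocycle ψ L ψL hψL c).1 τ : ψL.toAddMonoidHom.ker) : geomPoints (W'.baseChange L)) =
      baseExt W' L ((c.1 (resGal (K := K) L τ) : ψ.toAddMonoidHom.ker) : W'.geomPoints) :=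
  rfl

omit [W.IsElliptic] [W'.IsElliptic] [Fact p.Prime] [NeZero (p : K)] [(W.baseChange L).IsElliptic]
  [(W'.baseChange L).IsElliptic] in
/-- **The Selmer local condition at `L` is a coboundary for the restricted cocycle**: if the class of `c`
lies in `ψ.selmerLocalKer L` (it dies in `H¹(L, E')`), then `c_L(τ) = τQ' − Q'` for some `Q' ∈ E'_L(L̄)`.
[cite: SilvermanAEC2009, Thm. X.4.2 (the local conditions of the φ-Selmer group)] -/
theorem exists_coboundary_of_mem_selmerLocalKer
    (c : letI := ψ.kerAction
      contOneCocycles (discreteTopRep (absoluteGaloisGroup K) ψ.toAddMonoidHom.ker))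
    (hsel : letI := ψ.kerAction
      oneCocycleClass _ c ∈ ψ.selmerLocalKer L) :
    ∃ Q' : geomPoints (W'.baseChange L), ∀ τ : absoluteGaloisGroup L,
      (((resCocycle ψ L ψL hψL c).1 τ : ψL.toAddMonoidHom.ker) : geomPoints (W'.baseChange L)) =
        τ • Q' - Q' := by
  letI := ψ.kerAction
  unfold Isogeny.selmerLocalKer at hsel
  rw [oneCocycleClass_mem_resKer_iff] at hsel
  obtain ⟨a, ha⟩ := hsel
  refine ⟨localPointsEquivGeomPoints W' L a, fun τ ↦ ?_⟩
  rw [coe_resCocycle_apply, baseExt_apply]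
  have e := ha τ
  rw [AddMonoidHom.comp_apply, AddSubgroup.coe_subtype] at e
  rw [e, map_sub, localPointsEquivGeomPoints_smul]

/-! ## §4 The Weil pairings of `E` and `E_L` along `ι_*` -/

include hT hT0 in
omit [W'.IsElliptic] in
/-- **`e_L(ι_* S, ι_* T) = ι(e(S, T))^k` with a fixed `k` prime to `p`**, for all `S ∈ E[p]`: both
`S ↦ e_L(ι_* S, ι_* T)` and `S ↦ ι(e(S, T))` are characters of `E[p]` trivial exactly on `⟨T⟩` with values in
`μ_p(L̄)`; in a frame `S = aT + bS₁` both are `b`-th powers of their (primitive) values at `S₁`.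
[cite: SilvermanAEC2009, Prop. III.8.1(a)–(d)] -/
theorem exists_pow_weilPairingFun_baseExt_eq [NeZero (p : L)] :
    ∃ k : ℕ, ¬ p ∣ k ∧ ∀ S : W.geomPoints, (p : ℤ) • S = 0 →
      weilPairingFun (natCast_level_ne_zero L p) (baseExt W L S) (baseExt W L T) =
        closureEmb (K := K) L (weilPairingFun (natCast_level_ne_zero K p) S T) ^ k := by
  have hp : p.Prime := Fact.out
  have hTL := zsmul_baseExt_T T hT L
  have hTL0 := baseExt_T_ne_zero T hT0 L
  obtain ⟨S₁, hS₁, hprim, hformula⟩ := weilPairingFun_frame hT hT0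
  set ζ := weilPairingFun (natCast_level_ne_zero K p) S₁ T with hζ
  -- `ι ζ` is a primitive `p`-th root of unity in `L̄`
  have hprim' : IsPrimitiveRoot (closureEmb (K := K) L ζ) p :=
    hprim.map_of_injective (closureEmb (K := K) L).injective
  -- the value of the second character at `S₁`
  have hS₁L : (p : ℤ) • baseExt W L S₁ = 0 := by rw [← map_zsmul, hS₁, map_zero]
  set ζ' := weilPairingFun (natCast_level_ne_zero L p) (baseExt W L S₁) (baseExt W L T) with hζ'
  have hζ'p : ζ' ^ p = 1 := weilPairingFun_pow _ hS₁L hTL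
  obtain ⟨k, -, hk⟩ := hprim'.eq_pow_of_pow_eq_one hζ'p
  refine ⟨k, fun hpk ↦ ?_, fun S hS ↦ ?_⟩
  · -- `p ∣ k` would make `ζ' = 1`, i.e. `ι_* S₁ ∈ ⟨ι_* T⟩`, i.e. `S₁ ∈ ⟨T⟩`, i.e. `ζ = 1`
    have h1 : ζ' = 1 := by
      rw [← hk]
      obtain ⟨m, rfl⟩ := hpk
      rw [pow_mul, hprim'.pow_eq_one, one_pow]
    have hmem := mem_zmultiples_of_weilPairingFun_eq_one hTL hTL0 hS₁L h1
    obtain ⟨n, hn⟩ := exists_nsmul_eq_of_mem_zmultiples hTL hmem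
    rw [← map_nsmul] at hn
    have hS₁mem : S₁ ∈ AddSubgroup.zmultiples T := by
      rw [← baseExt_injective W L hn]
      exact (AddSubgroup.zmultiples T).nsmul_mem (AddSubgroup.mem_zmultiples T) n
    have hζ1 : ζ = 1 := weilPairingFun_eq_one_of_mem_zmultiples hT hS₁mem
    exact hprim.ne_one hp.one_lt hζ1
  · obtain ⟨a, b, -, rfl, hf⟩ := hformula S hS
    have haT : (p : ℤ) • (a • T) = 0 := by rw [smul_comm, hT, smul_zero]
    have hbS : (p : ℤ) • (b • S₁) = 0 := by rw [smul_comm, hS₁, smul_zero]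
    have haTL : (p : ℤ) • (a • baseExt W L T) = 0 := by rw [smul_comm, hTL, smul_zero]
    have hbSL : (p : ℤ) • (b • baseExt W L S₁) = 0 := by rw [smul_comm, hS₁L, smul_zero]
    rw [hf, map_add, map_nsmul, map_nsmul, weilPairingFun_add_left _ haTL hbSL hTL,
      weilPairingFun_nsmul_self hTL a, one_mul, weilPairingFun_nsmul_left _ hS₁L hTL, ← hζ', ← hk,
      map_pow, ← pow_mul, ← pow_mul, mul_comm]

/-! ## §5 The local Kummer generator and the local descent value -/

variable [CharZero L]

include h hT hT0 hker hφL hψL hφLcard in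
/-- **The global Kummer generator gives the local one.** If `(α, a)` is a Kummer generator of the cocycle
`c : Γ_K → ker ψ` (`χ(c σ) = σα/α`, `αᵖ = a ∈ Kˣ`), then with `k` from `exists_pow_weilPairingFun_baseExt_eq`,
`χ_L(c_L τ) = τ(ι α)^k/(ι α)^k` for all `τ ∈ Γ_L`, and `((ι α)^k)ᵖ = aᵏ` — `((ι α)^k, aᵏ)` is a Kummer generator of
`c_L` for the character `χ_L` of the pair `(φ_L, ψ_L, T_L)`. [cite: SilvermanAEC2009, Exercise 10.1(c) and Prop. X.4.9]
[cite: SerreGaloisCohomology1997, II.§1.1] -/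
theorem exists_localKummerGenerator
    (c : letI := ψ.kerAction
      contOneCocycles (discreteTopRep (absoluteGaloisGroup K) ψ.toAddMonoidHom.ker))
    {α : (AlgebraicClosure K)ˣ} {a : Kˣ}
    (hαp : α ^ p = Units.map (algebraMap K (AlgebraicClosure K) : K →* AlgebraicClosure K) a)
    (hcα : ∀ σ : absoluteGaloisGroup K, muVal K p (dualKerChar φ ψ h T hT hker (c.1 σ)) = σ • α / α) :
    ∃ (k : ℕ) (αL : (AlgebraicClosure L)ˣ), ¬ p ∣ k ∧
      αL ^ p = Units.map (algebraMap L (AlgebraicClosure L) : L →* AlgebraicClosure L)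
        (Units.map (algebraMap K L : K →* L) a ^ k) ∧
      ∀ τ : absoluteGaloisGroup L,
        muVal L p (dualKerChar φL ψL (comp_eq_zsmul_of_baseChange φ ψ h L φL ψL hφL hψL) (baseExt W L T)
          (zsmul_baseExt_T T hT L) (ker_baseChange_eq_zmultiples φ T hT hT0 hker L φL hφL hφLcard)
          ((resCocycle ψ L ψL hψL c).1 τ)) = τ • αL / αL := by
  letI := ψ.kerAction; letI := ψL.kerAction
  obtain ⟨k, hpk, hkS⟩ := exists_pow_weilPairingFun_baseExt_eq T hT hT0 L
  -- `ι α` as a unit of `L̄`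
  set αL₁ : (AlgebraicClosure L)ˣ := Units.map (closureEmb (K := K) L : AlgebraicClosure K →* AlgebraicClosure L) α
    with hαL₁
  refine ⟨k, αL₁ ^ k, hpk, ?_, fun τ ↦ ?_⟩
  · -- `((ι α)^k)^p = ι(α^p)^k = ι(a)^k = (algebraMap L L̄ (algebraMap K L a))^k`
    rw [← pow_mul, mul_comm, pow_mul, hαL₁, ← map_pow, hαp, map_pow]
    congr 1
    ext
    simp only [Units.coe_map, MonoidHom.coe_coe, AlgHom.commutes]
    exact (IsScalarTower.algebraMap_apply K L (AlgebraicClosure L) (a : K))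
  · -- a `φ`-preimage `S` of `c(τ|_K̄)` gives the `φ_L`-preimage `ι_* S` of `c_L(τ)`
    obtain ⟨S, hS, hSQ⟩ := (mem_ker_dual_iff φ ψ h _).mp (c.1 (resGal (K := K) L τ)).2
    have hSz : (p : ℤ) • S = 0 := by rw [natCast_zsmul]; exact AddSubgroup.torsionBy.nsmul_iff.mp hS
    have hSL : (p : ℤ) • baseExt W L S = 0 := by rw [← map_zsmul, hSz, map_zero]
    have hSLQ : φL (baseExt W L S) = (((resCocycle ψ L ψL hψL c).1 τ : ψL.toAddMonoidHom.ker) :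
        geomPoints (W'.baseChange L)) := by
      rw [hφL, hSQ, coe_resCocycle_apply]
    apply Units.ext
    have eL := coe_muVal_dualKerChar_eq φL ψL (comp_eq_zsmul_of_baseChange φ ψ h L φL ψL hφL hψL)
      (baseExt W L T) (zsmul_baseExt_T T hT L)
      (ker_baseChange_eq_zmultiples φ T hT hT0 hker L φL hφL hφLcard) _ hSL hSLQ
    have eK := coe_muVal_dualKerChar_eq φ ψ h T hT hker _ hSz hSQ
    rw [eL, hkS S hSz, ← eK, hcα]
    simp only [hαL₁, Units.val_div_eq_div_val, Units.coe_smul, Units.val_pow_eq_pow_val, Units.coe_map,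
      MonoidHom.coe_coe, map_div₀, closureEmb_resGal_smul, div_pow, smul_pow']

include h hT hT0 hTfix hker hφL hψL hφLcard in
/-- **`P = O`: the Kummer invariant is locally a `p`-th power.** If `[c] ∈ ψ.selmerLocalKer L` with
`c_L(τ) = τQ' − Q'` and `ψ_L(Q') = O`, then `aᵏ = uᵖ` in `L` for a global Kummer generator `(α, a)` of `c`
(`Q' = φ_L(R)` with `R ∈ E_L[p]`, so `χ_L(c_L τ) = e_L(τR − R, T_L) = τζ/ζ` with `ζ = e_L(R, T_L) ∈ μ_p`).
[cite: SilvermanAEC2009, Exercise 10.1(c) and Prop. X.4.9] -/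
theorem exists_pow_eq_pow_of_psi_eq_zero
    (c : letI := ψ.kerAction
      contOneCocycles (discreteTopRep (absoluteGaloisGroup K) ψ.toAddMonoidHom.ker))
    {Q' : geomPoints (W'.baseChange L)}
    (hc : ∀ τ : absoluteGaloisGroup L,
      (((resCocycle ψ L ψL hψL c).1 τ : ψL.toAddMonoidHom.ker) : geomPoints (W'.baseChange L)) = τ • Q' - Q')
    (hP : ψL Q' = 0)
    {α : (AlgebraicClosure K)ˣ} {a : Kˣ}
    (hαp : α ^ p = Units.map (algebraMap K (AlgebraicClosure K) : K →* AlgebraicClosure K) a)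
    (hcα : ∀ σ : absoluteGaloisGroup K, muVal K p (dualKerChar φ ψ h T hT hker (c.1 σ)) = σ • α / α) :
    ∃ (k : ℕ) (u : L), ¬ p ∣ k ∧ u ≠ 0 ∧ (algebraMap K L a) ^ k = u ^ p := by
  letI := ψ.kerAction; letI := ψL.kerAction
  have hLp := comp_eq_zsmul_of_baseChange φ ψ h L φL ψL hφL hψL
  have hTL := zsmul_baseExt_T T hT L
  have hTLfix := smul_baseExt_T T hTfix L
  have hkerL := ker_baseChange_eq_zmultiples φ T hT hT0 hker L φL hφL hφLcard
  obtain ⟨k, αL, hpk, hαLp, hgen⟩ :=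
    exists_localKummerGenerator φ ψ h T hT hT0 hker L φL ψL hφL hψL hφLcard c hαp hcα
  -- `Q' = φ_L R` with `pR = ψ_L Q' = O`
  obtain ⟨R, hRQ⟩ := φL.surjective Q'
  have hRp : (p : ℤ) • R = 0 := by rw [← hLp, hRQ, hP]
  -- `χ_L(c_L τ) = e_L(τR − R, T_L) = τζ/ζ`, `ζ = e_L(R, T_L)`
  set ζ := weilPairingFun (natCast_level_ne_zero L p) R (baseExt W L T) with hζ
  have hζp : ζ ^ p = 1 := weilPairingFun_pow _ hRp hTL
  have hζ0 : ζ ≠ 0 := fun h0 ↦ by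
    rw [h0, zero_pow (Fact.out : p.Prime).ne_zero] at hζp; exact zero_ne_one hζp
  have hcoc : ∀ τ : absoluteGaloisGroup L, τ • (αL : AlgebraicClosure L) / αL = τ • ζ / ζ := by
    intro τ
    have e := congrArg (fun x : (AlgebraicClosure L)ˣ ↦ (x : AlgebraicClosure L)) (hgen τ)
    simp only [Units.val_div_eq_div_val, Units.coe_smul] at e
    rw [dualKerChar_eq_weilPairingFun_of_coboundary φL ψL hLp (baseExt W L T) hTL hkerL _ hc hRQ] at e
    have hτR : (p : ℤ) • (τ • R) = 0 := by rw [smul_comm, hRp, smul_zero]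
    have hneg : (p : ℤ) • (-R) = 0 := by rw [smul_neg, hRp, neg_zero]
    rw [← e, sub_eq_add_neg, weilPairingFun_add_left _ hτR hneg hTL]
    -- `e(τR, T_L) = τ e(R, T_L)` (Galois equivariance, `τ T_L = T_L`) and `e(−R, T_L) = e(R, T_L)⁻¹`
    have h1 : weilPairingFun (natCast_level_ne_zero L p) (τ • R) (baseExt W L T) = τ • ζ := by
      rw [hζ, ← weilPairingFun_smul _ τ hRp hTL, hTLfix]
    have h2 : weilPairingFun (natCast_level_ne_zero L p) (-R) (baseExt W L T) * ζ = 1 := by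
      rw [hζ, ← weilPairingFun_add_left _ hneg hRp hTL, neg_add_cancel, weilPairingFun_zero_left _ hTL]
    rw [h1, eq_div_iff hζ0, mul_assoc, h2, mul_one]
  -- so `αL / ζ` is `Γ_L`-fixed
  have hfix : ∀ τ : absoluteGaloisGroup L, galRingHom τ ((αL : AlgebraicClosure L) / ζ) = αL / ζ := by
    intro τ
    have e := hcoc τ
    rw [div_eq_div_iff αL.ne_zero hζ0] at e
    rw [map_div₀, galRingHom_apply, galRingHom_apply, div_eq_div_iff (smul_ne_zero_iff_ne τ |>.mpr hζ0) hζ0]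
    linear_combination e
  obtain ⟨u, hu⟩ := exists_algebraMap_of_forall_galRingHom hfix
  have hu0 : u ≠ 0 := by
    intro h0; rw [h0, map_zero, eq_comm, div_eq_zero_iff] at hu; exact hu.elim αL.ne_zero hζ0
  refine ⟨k, u, hpk, hu0, ?_⟩
  apply (algebraMap L (AlgebraicClosure L)).injective
  have e := congrArg (fun x : (AlgebraicClosure L)ˣ ↦ (x : AlgebraicClosure L)) hαLp
  simp only [Units.val_pow_eq_pow_val, Units.coe_map, MonoidHom.coe_coe] at e
  have hαeq : (αL : AlgebraicClosure L) = algebraMap L (AlgebraicClosure L) u * ζ := by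
    rw [hu, div_mul_cancel₀ _ hζ0]
  rw [← e, hαeq, mul_pow, hζp, mul_one, map_pow]

section Descent

variable {fL : (W.baseChange L).geomFunctionField} (hfL0 : fL ≠ 0)
  (hfLord : ∀ Q : geomPoints (W.baseChange L),
    ord ((W.baseChange L).baseChange (AlgebraicClosure L)).toAffine Q fL =
      (p : ℤ) * ((if Q = baseExt W L T then 1 else 0) - (if Q = 0 then 1 else 0)))

include h hT hT0 hTfix hker hφL hψL hφLcard hfL0 hfLord in
/-- **THE LOCAL CONDITION READ IN `Lˣ/Lˣᵖ`: the Kummer invariant is a local descent value.** Let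
`[c] ∈ H¹(K, ker ψ)` restrict at `L` to a coboundary `c_L(τ) = τQ' − Q'` (the Selmer condition at `L`,
`exists_coboundary_of_mem_selmerLocalKer`), put `P = ψ_L(Q')` (an `L`-rational point of `E_L`) and assume
`P ∉ {O, T_L}`, `f_L(P) = b` for a Kummer function `f_L` of `T_L` on `E_L` (`div f_L = p(T_L) − p(O)`). Let
`Q₀ ∈ E_L(L̄)` be `Γ_L`-fixed with `pQ₀ ∉ {O, T_L}`, `f_L(pQ₀) = a₀`. Then a global Kummer generator `(α, a)` of `c`
satisfies **`aᵏ · uᵖ · a₀ = b`** in `L̄` for some `u ∈ Lˣ` and a fixed `k` with `p ∤ k`: up to `Lˣᵖ` and a unit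
exponent, `a` is the descent value `f_L(P)/f_L(P₀)`. [cite: SilvermanAEC2009, Prop. X.4.9 and Exercise 10.1(c)]
[cite: Fisher2001FiveSevenDescent, §1] -/
theorem exists_pow_mul_pow_eq_value_of_coboundary
    (c : letI := ψ.kerAction
      contOneCocycles (discreteTopRep (absoluteGaloisGroup K) ψ.toAddMonoidHom.ker))
    {Q' : geomPoints (W'.baseChange L)}
    (hc : ∀ τ : absoluteGaloisGroup L,
      (((resCocycle ψ L ψL hψL c).1 τ : ψL.toAddMonoidHom.ker) : geomPoints (W'.baseChange L)) = τ • Q' - Q')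
    (hP0 : ψL Q' ≠ 0) (hPT : ψL Q' ≠ baseExt W L T) {b : AlgebraicClosure L}
    (hb : (W.baseChange L).HasValueAt fL (ψL Q') b)
    {Q₀ : geomPoints (W.baseChange L)} (hQ₀0 : (p : ℤ) • Q₀ ≠ 0) (hQ₀T : (p : ℤ) • Q₀ ≠ baseExt W L T)
    (hQ₀fix : ∀ τ : absoluteGaloisGroup L, τ • Q₀ = Q₀) {a₀ : AlgebraicClosure L}
    (ha₀ : (W.baseChange L).HasValueAt fL ((p : ℤ) • Q₀) a₀)
    {α : (AlgebraicClosure K)ˣ} {a : Kˣ}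
    (hαp : α ^ p = Units.map (algebraMap K (AlgebraicClosure K) : K →* AlgebraicClosure K) a)
    (hcα : ∀ σ : absoluteGaloisGroup K, muVal K p (dualKerChar φ ψ h T hT hker (c.1 σ)) = σ • α / α) :
    ∃ (k : ℕ) (u : L), ¬ p ∣ k ∧ u ≠ 0 ∧
      algebraMap L (AlgebraicClosure L) ((algebraMap K L a) ^ k * u ^ p) * a₀ = b := by
  letI := ψ.kerAction; letI := ψL.kerAction
  have hLp := comp_eq_zsmul_of_baseChange φ ψ h L φL ψL hφL hψL
  have hTL := zsmul_baseExt_T T hT L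
  have hTL0 := baseExt_T_ne_zero T hT0 L
  have hTLfix := smul_baseExt_T T hTfix L
  have hkerL := ker_baseChange_eq_zmultiples φ T hT hT0 hker L φL hφL hφLcard
  obtain ⟨k, αL, hpk, hαLp, hgen⟩ :=
    exists_localKummerGenerator φ ψ h T hT hT0 hker L φL ψL hφL hψL hφLcard c hαp hcα
  obtain ⟨u, hu0, hu⟩ := exists_mul_pow_eq_value_of_coboundary φL ψL hLp (baseExt W L T) hTL hTLfix hkerL
    hfL0 hfLord _ hc hP0 hPT hb hQ₀0 hQ₀T hQ₀fix ha₀ hαLp hgen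
  refine ⟨k, u, hpk, hu0, ?_⟩
  rw [← hu]
  simp only [Units.val_pow_eq_pow_val, Units.coe_map, MonoidHom.coe_coe]

end Descent

end OverL

end WeierstrassCurve.Isogeny

end
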